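import Summits.HodgeConjecture.HodgeConjecture.Theorems.NikulinTwinTransportHodgeIsometryAlgebraicGysinBaseChange
import Literature.AlgebraicTopology.SingularHomology.CupProductProofs

/-!
# Route NikulinTwinTransport · item `SquareHodgeOfSqrtTwo` (stmt-HodgeConjecture-13680) —
# cup products of cross products on `(S ⊗ S)(ℂ)`, the pairing formula and the correspondence
# formula for Künneth normal forms

Second file of the Künneth bookkeeping for the square of a projective K3 surface (see
`…SquareKunneth` for the normal forms and `…SquareHodgeOfSqrtTwo` for the assembly). Pure
cup-product algebra on the product (Hatcher, *Algebraic Topology*, §3.2: associativity, graded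
commutativity Thm. 3.11, naturality Prop. 3.10 — all PROVED in the tree), and the two formulas by
which a Künneth normal form `z = Σᵢ fst^* vᵢ ∪ snd^* uᵢ + t₄ • snd^* p + t₀ • fst^* p` of a class
`z ∈ H⁴((S ⊗ S)(ℂ); ℂ)` is read off on `H²(S(ℂ); ℂ)` (with `a ∪ b = B(a,b) • p` on `H²(S(ℂ); ℂ)`):

* `normalForm_cup_cross` — the **pairing formula**
  `z ∪ (fst^* x ∪ snd^* y) = (Σᵢ B(vᵢ, x) B(uᵢ, y)) • (fst^* p ∪ snd^* p)` (Künneth ring structure,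
  Hatcher Thm. 3.16: `(a × b) ∪ (c × d) = (-1)^{|b||c|} (a ∪ c) × (b ∪ d)`);
* `corr_normalForm` — the **correspondence formula**
  `[z]_* x = fst_*(snd^* x ∪ z) = c₀ • Σᵢ B(x, uᵢ) • vᵢ`, granted fibre integration
  `fst_*(snd^* p) = c₀ • 1` (projection formula, Fulton *Young Tableaux* App. B (6); the action of a
  Künneth decomposable correspondence, Fulton *Intersection Theory* §16.1).

## References

* [HatcherAT2002] A. Hatcher, Algebraic Topology, CUP 2002, §3.2 Prop. 3.10, Thm. 3.11, Thm. 3.16.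
* [FultonYoungTableaux1997] W. Fulton, Young Tableaux, CUP 1997, Appendix B §B.1 (3)–(6).
* [Fulton1998] W. Fulton, Intersection Theory, 2nd ed., Springer 1998, §16.1.
-/

noncomputable section

open CategoryTheory AlgebraicGeometry MonoidalCategory CartesianMonoidalCategory
open Literature.AlgebraicGeometry.Motives Literature.AlgebraicGeometry.HodgeTheory
open Literature.AlgebraicTopology.SingularHomology

namespace Summit.HodgeConjecture.HodgeConjecture.Theorems.NikulinTwinTransport

variable {X Y : SchemeOver ℂ}

/-! ### Cup products of cross products -/

/-- `fst^* a ∪ (fst^* x ∪ snd^* y) = fst^*(a ∪ x) ∪ snd^* y` (associativity and naturality of `∪`).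
[cite: HatcherAT2002, §3.2 Prop. 3.10] -/
theorem map_fst_cup_cross {i k l m n s : ℕ} (hkl : k + l = m) (him : i + m = n) (hik : i + k = s)
    (hsl : s + l = n) (a : complexBetti X i) (x : complexBetti X k) (y : complexBetti Y l) :
    cupProduct him (complexBetti.map (fst X Y) i a)
        (cupProduct hkl (complexBetti.map (fst X Y) k x) (complexBetti.map (snd X Y) l y)) =
      cupProduct hsl (complexBetti.map (fst X Y) s (cupProduct hik a x))
        (complexBetti.map (snd X Y) l y) := by
  rw [← cupProduct_assoc hik hkl hsl him, ← cupProduct_map (AlgPoints.mapContinuous (L := ℂ) (fst X Y))]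

/-- `(fst^* x ∪ snd^* y) ∪ snd^* b = fst^* x ∪ snd^*(y ∪ b)` (associativity and naturality of `∪`).
[cite: HatcherAT2002, §3.2 Prop. 3.10] -/
theorem cross_cup_map_snd {j k l m n s : ℕ} (hkl : k + l = m) (hmj : m + j = n) (hlj : l + j = s)
    (hks : k + s = n) (x : complexBetti X k) (y : complexBetti Y l) (b : complexBetti Y j) :
    cupProduct hmj (cupProduct hkl (complexBetti.map (fst X Y) k x) (complexBetti.map (snd X Y) l y))
        (complexBetti.map (snd X Y) j b) =
      cupProduct hks (complexBetti.map (fst X Y) k x)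
        (complexBetti.map (snd X Y) s (cupProduct hlj y b)) := by
  rw [cupProduct_assoc hkl hlj hmj hks, ← cupProduct_map (AlgPoints.mapContinuous (L := ℂ) (snd X Y))]

/-- `snd^* b ∪ (fst^* x ∪ snd^* y) = (-1)^{jk} • fst^* x ∪ snd^*(b ∪ y)` (graded commutativity,
associativity and naturality of `∪`). [cite: HatcherAT2002, §3.2 Thm. 3.11 and Prop. 3.10] -/
theorem map_snd_cup_cross {j k l m n s : ℕ} (hkl : k + l = m) (hjm : j + m = n) (hjl : j + l = s)
    (hks : k + s = n) (b : complexBetti Y j) (x : complexBetti X k) (y : complexBetti Y l) :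
    cupProduct hjm (complexBetti.map (snd X Y) j b)
        (cupProduct hkl (complexBetti.map (fst X Y) k x) (complexBetti.map (snd X Y) l y)) =
      ((-1 : ℂ) ^ (j * k)) • cupProduct hks (complexBetti.map (fst X Y) k x)
        (complexBetti.map (snd X Y) s (cupProduct hjl b y)) := by
  rw [← cupProduct_assoc (rfl : j + k = j + k) hkl (show j + k + l = n by omega) hjm,
    cupProduct_gradedComm_holds ℂ _ (rfl : j + k = j + k) (show k + j = j + k by omega), map_smul,
    LinearMap.smul_apply, cupProduct_assoc (show k + j = j + k by omega) hjl
      (show j + k + l = n by omega) hks,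
    ← cupProduct_map (AlgPoints.mapContinuous (L := ℂ) (snd X Y))]

/-- `(fst^* x ∪ snd^* y) ∪ fst^* a = (-1)^{li} • fst^*(x ∪ a) ∪ snd^* y` (graded commutativity,
associativity and naturality of `∪`). [cite: HatcherAT2002, §3.2 Thm. 3.11 and Prop. 3.10] -/
theorem cross_cup_map_fst {i k l m n s : ℕ} (hkl : k + l = m) (hmi : m + i = n) (hki : k + i = s)
    (hsl : s + l = n) (x : complexBetti X k) (y : complexBetti Y l) (a : complexBetti X i) :
    cupProduct hmi (cupProduct hkl (complexBetti.map (fst X Y) k x) (complexBetti.map (snd X Y) l y))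
        (complexBetti.map (fst X Y) i a) =
      ((-1 : ℂ) ^ (l * i)) • cupProduct hsl (complexBetti.map (fst X Y) s (cupProduct hki x a))
        (complexBetti.map (snd X Y) l y) := by
  rw [cupProduct_assoc hkl (rfl : l + i = l + i) hmi (show k + (l + i) = n by omega),
    cupProduct_gradedComm_holds ℂ _ (rfl : l + i = l + i) (show i + l = l + i by omega), map_smul,
    ← cupProduct_assoc hki (show i + l = l + i by omega) hsl (show k + (l + i) = n by omega),
    ← cupProduct_map (AlgPoints.mapContinuous (L := ℂ) (fst X Y))]

/-- **`(fst^* a ∪ snd^* b) ∪ (fst^* x ∪ snd^* y) = (-1)^{jk} • fst^*(a ∪ x) ∪ snd^*(b ∪ y)`** — the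
ring structure of `H^*(X × Y)` on cross products (Hatcher Thm. 3.16).
[cite: HatcherAT2002, §3.2 Thm. 3.16] -/
theorem cross_cup_cross {i j k l m m' n s s' : ℕ} (hij : i + j = m') (hkl : k + l = m)
    (hmm : m' + m = n) (hik : i + k = s) (hjl : j + l = s') (hss : s + s' = n)
    (a : complexBetti X i) (b : complexBetti Y j) (x : complexBetti X k) (y : complexBetti Y l) :
    cupProduct hmm (cupProduct hij (complexBetti.map (fst X Y) i a) (complexBetti.map (snd X Y) j b))
        (cupProduct hkl (complexBetti.map (fst X Y) k x) (complexBetti.map (snd X Y) l y)) =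
      ((-1 : ℂ) ^ (j * k)) • cupProduct hss (complexBetti.map (fst X Y) s (cupProduct hik a x))
        (complexBetti.map (snd X Y) s' (cupProduct hjl b y)) := by
  rw [cupProduct_assoc hij (show j + m = j + m from rfl) hmm (show i + (j + m) = n by omega),
    map_snd_cup_cross hkl (show j + m = j + m from rfl) hjl (show k + s' = j + m by omega), map_smul,
    map_fst_cup_cross (show k + s' = j + m by omega) (show i + (j + m) = n by omega) hik hss]

/-! ### The square of a surface: pairing formula and correspondence formula for normal forms -/

section Surface

variable {S : SchemeOver ℂ} (hS : IsSmoothProjective 2 S) {p : complexBetti S (2 * 2)}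
  {B : complexBetti S (2 * 1) → complexBetti S (2 * 1) → ℂ}
  (hB : ∀ a b : complexBetti S (2 * 1), cupProduct (rfl : 2 * 1 + 2 * 1 = 2 * 2) a b = B a b • p)

include hS hB

omit hS in
/-- `(fst^* v ∪ snd^* u) ∪ (fst^* x ∪ snd^* y) = (B(v, x) B(u, y)) • (fst^* p ∪ snd^* p)` for classes of
`H²(S(ℂ); ℂ)` on a surface with `a ∪ b = B(a, b) • p`. [cite: HatcherAT2002, §3.2 Thm. 3.16] -/
theorem cross_two_cup_cross_two (v u x y : complexBetti S (2 * 1)) :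
    cupProduct (rfl : 2 * 2 + 2 * 2 = 2 * 4)
        (cupProduct (rfl : 2 * 1 + 2 * 1 = 2 * 2) (complexBetti.map (fst S S) (2 * 1) v)
          (complexBetti.map (snd S S) (2 * 1) u))
        (cupProduct (rfl : 2 * 1 + 2 * 1 = 2 * 2) (complexBetti.map (fst S S) (2 * 1) x)
          (complexBetti.map (snd S S) (2 * 1) y)) =
      (B v x * B u y) • cupProduct (rfl : 2 * 2 + 2 * 2 = 2 * 4)
        (complexBetti.map (fst S S) (2 * 2) p) (complexBetti.map (snd S S) (2 * 2) p) := by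
  rw [cross_cup_cross rfl rfl (rfl : 2 * 2 + 2 * 2 = 2 * 4) (rfl : 2 * 1 + 2 * 1 = 2 * 2)
    (rfl : 2 * 1 + 2 * 1 = 2 * 2) rfl, hB v x, hB u y, map_smul, map_smul, map_smul, map_smul,
    LinearMap.smul_apply, smul_smul, smul_smul]
  norm_num [mul_comm]

omit hB in
/-- `snd^* p ∪ (fst^* x ∪ snd^* y) = 0` on the square of a surface (`p ∪ y ∈ H⁶(S(ℂ)) = 0`).
[cite: HatcherAT2002, §3.2 Thm. 3.16] -/
theorem map_snd_top_cup_cross_two (x y : complexBetti S (2 * 1)) :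
    cupProduct (rfl : 2 * 2 + 2 * 2 = 2 * 4) (complexBetti.map (snd S S) (2 * 2) p)
        (cupProduct (rfl : 2 * 1 + 2 * 1 = 2 * 2) (complexBetti.map (fst S S) (2 * 1) x)
          (complexBetti.map (snd S S) (2 * 1) y)) = 0 := by
  haveI := subsingleton_complexBetti hS (show 2 * 2 < 2 * 3 by norm_num)
  rw [map_snd_cup_cross rfl (rfl : 2 * 2 + 2 * 2 = 2 * 4) (rfl : 2 * 2 + 2 * 1 = 2 * 3)
    (rfl : 2 * 1 + 2 * 3 = 2 * 4), Subsingleton.elim (cupProduct _ p y) 0, map_zero, map_zero, smul_zero]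

omit hB in
/-- `fst^* p ∪ (fst^* x ∪ snd^* y) = 0` on the square of a surface (`p ∪ x ∈ H⁶(S(ℂ)) = 0`).
[cite: HatcherAT2002, §3.2 Thm. 3.16] -/
theorem map_fst_top_cup_cross_two (x y : complexBetti S (2 * 1)) :
    cupProduct (rfl : 2 * 2 + 2 * 2 = 2 * 4) (complexBetti.map (fst S S) (2 * 2) p)
        (cupProduct (rfl : 2 * 1 + 2 * 1 = 2 * 2) (complexBetti.map (fst S S) (2 * 1) x)
          (complexBetti.map (snd S S) (2 * 1) y)) = 0 := by
  haveI := subsingleton_complexBetti hS (show 2 * 2 < 2 * 3 by norm_num)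
  rw [map_fst_cup_cross rfl (rfl : 2 * 2 + 2 * 2 = 2 * 4) (rfl : 2 * 2 + 2 * 1 = 2 * 3)
    (rfl : 2 * 3 + 2 * 1 = 2 * 4), Subsingleton.elim (cupProduct _ p x) 0, map_zero, map_zero,
    LinearMap.zero_apply]

/-- **Pairing formula for a Künneth normal form**: for `z = Σᵢ fst^* vᵢ ∪ snd^* uᵢ + t₄ • snd^* p +
t₀ • fst^* p` in `H⁴((S ⊗ S)(ℂ); ℂ)` and `x, y ∈ H²(S(ℂ); ℂ)`,
`z ∪ (fst^* x ∪ snd^* y) = (Σᵢ B(vᵢ, x) B(uᵢ, y)) • (fst^* p ∪ snd^* p)`.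
[cite: HatcherAT2002, §3.2 Thm. 3.16] -/
theorem normalForm_cup_cross {ι : Type} [Fintype ι] (v u : ι → complexBetti S (2 * 1)) (t₄ t₀ : ℂ)
    (x y : complexBetti S (2 * 1)) :
    cupProduct (rfl : 2 * 2 + 2 * 2 = 2 * 4)
        ((∑ i, cupProduct (rfl : 2 * 1 + 2 * 1 = 2 * 2) (complexBetti.map (fst S S) (2 * 1) (v i))
            (complexBetti.map (snd S S) (2 * 1) (u i))) +
          t₄ • complexBetti.map (snd S S) (2 * 2) p + t₀ • complexBetti.map (fst S S) (2 * 2) p)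
        (cupProduct (rfl : 2 * 1 + 2 * 1 = 2 * 2) (complexBetti.map (fst S S) (2 * 1) x)
          (complexBetti.map (snd S S) (2 * 1) y)) =
      (∑ i, B (v i) x * B (u i) y) • cupProduct (rfl : 2 * 2 + 2 * 2 = 2 * 4)
        (complexBetti.map (fst S S) (2 * 2) p) (complexBetti.map (snd S S) (2 * 2) p) := by
  simp only [map_add, map_sum, map_smul, LinearMap.add_apply, LinearMap.sum_apply,
    LinearMap.smul_apply, map_snd_top_cup_cross_two hS, map_fst_top_cup_cross_two hS,
    cross_two_cup_cross_two hB, smul_zero, add_zero, Finset.sum_smul]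

/-- **The action of a cross product as a correspondence**: granted fibre integration
`fst_*(snd^* p) = c₀ • 1_S`, `fst_*(snd^* x ∪ (fst^* v ∪ snd^* u)) = (c₀ B(x, u)) • v` — the rank-one
map `x ↦ (x.u) v` (projection formula `fst_*(fst^* v ∪ snd^* q) = v ∪ fst_* snd^* q`).
[cite: Fulton1998, §16.1] [cite: FultonYoungTableaux1997, Appendix B §B.1 (6)] -/
theorem corr_cross (μ : OrientationFamily) {c₀ : ℂ}
    (hFI : complexGysin μ (IsSmoothProjective.tensor_holds hS hS) hS (fst S S)
        (rfl : 2 * 2 + 2 * 2 = 0 + 2 * (2 + 2)) (complexBetti.map (snd S S) (2 * 2) p) =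
      c₀ • singularCohomology.one ℂ (ComplexPoints S))
    (v u x : complexBetti S (2 * 1)) :
    complexGysin μ (IsSmoothProjective.tensor_holds hS hS) hS (fst S S)
        (rfl : 2 * 1 + 2 * 2 + 2 * 2 = 2 * 1 + 2 * (2 + 2))
        (cupProduct (rfl : 2 * 1 + 2 * 2 = 2 * 1 + 2 * 2) (complexBetti.map (snd S S) (2 * 1) x)
          (cupProduct (rfl : 2 * 1 + 2 * 1 = 2 * 2) (complexBetti.map (fst S S) (2 * 1) v)
            (complexBetti.map (snd S S) (2 * 1) u))) = (c₀ * B x u) • v := by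
  have hμ : μ.HasPoincareDuality := OrientationFamily.hasPoincareDuality μ
  rw [map_snd_cup_cross rfl (rfl : 2 * 1 + 2 * 2 = 2 * 1 + 2 * 2) (rfl : 2 * 1 + 2 * 1 = 2 * 2)
    (rfl : 2 * 1 + 2 * 2 = 2 * 1 + 2 * 2), hB x u, map_smul, map_smul, map_smul, map_smul,
    complexGysin_cup hμ (IsSmoothProjective.tensor_holds hS hS) hS (fst S S)
      (rfl : 2 * 1 + 2 * 2 = 2 * 1 + 2 * 2) (rfl : 2 * 1 + 2 * 2 + 2 * 2 = 2 * 1 + 2 * (2 + 2))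
      (rfl : 2 * 2 + 2 * 2 = 0 + 2 * (2 + 2)) (rfl : 2 * 1 + 0 = 2 * 1), hFI, map_smul, cupProduct_one,
    smul_smul, smul_smul]
  norm_num [mul_comm]

omit hB in
/-- `fst_*(snd^* x ∪ snd^* p) = 0` (`snd^* x ∪ snd^* p = snd^*(x ∪ p)`, `x ∪ p ∈ H⁶(S(ℂ)) = 0`).
[cite: FultonYoungTableaux1997, Appendix B §B.1 (3)] -/
theorem corr_map_snd_top (μ : OrientationFamily) (x : complexBetti S (2 * 1)) :
    complexGysin μ (IsSmoothProjective.tensor_holds hS hS) hS (fst S S)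
        (rfl : 2 * 1 + 2 * 2 + 2 * 2 = 2 * 1 + 2 * (2 + 2))
        (cupProduct (rfl : 2 * 1 + 2 * 2 = 2 * 1 + 2 * 2) (complexBetti.map (snd S S) (2 * 1) x)
          (complexBetti.map (snd S S) (2 * 2) p)) = 0 := by
  haveI := subsingleton_complexBetti hS (show 2 * 2 < 2 * 1 + 2 * 2 by norm_num)
  rw [← cupProduct_map (AlgPoints.mapContinuous (L := ℂ) (snd S S)),
    Subsingleton.elim (cupProduct _ x p) 0, map_zero, map_zero]

omit hB in
/-- `fst_*(snd^* x ∪ fst^* p) = 0` for `x ∈ H²(S(ℂ))` (`= ± fst_*(fst^* p ∪ snd^* x)`, and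
`fst(ℂ)_*(snd^* x ⌢ [S × S]) ∈ H₆(S(ℂ)) = 0`). [cite: FultonYoungTableaux1997, Appendix B §B.1 (5)–(6)] -/
theorem corr_map_fst_top (μ : OrientationFamily) (x : complexBetti S (2 * 1)) :
    complexGysin μ (IsSmoothProjective.tensor_holds hS hS) hS (fst S S)
        (rfl : 2 * 1 + 2 * 2 + 2 * 2 = 2 * 1 + 2 * (2 + 2))
        (cupProduct (rfl : 2 * 1 + 2 * 2 = 2 * 1 + 2 * 2) (complexBetti.map (snd S S) (2 * 1) x)
          (complexBetti.map (fst S S) (2 * 2) p)) = 0 := by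
  rw [cupProduct_gradedComm_holds ℂ _ (rfl : 2 * 1 + 2 * 2 = 2 * 1 + 2 * 2)
    (rfl : 2 * 2 + 2 * 1 = 2 * 1 + 2 * 2), map_smul,
    complexGysin_cup_map_eq_zero_of_lt (IsSmoothProjective.tensor_holds hS hS) hS (fst S S)
      (rfl : 2 * 2 + 2 * 1 = 2 * 1 + 2 * 2) _ (by norm_num), smul_zero]

/-- **Correspondence formula for a Künneth normal form**: granted fibre integration
`fst_*(snd^* p) = c₀ • 1_S`, the correspondence `[z]_* x = fst_*(snd^* x ∪ z)` of
`z = Σᵢ fst^* vᵢ ∪ snd^* uᵢ + t₄ • snd^* p + t₀ • fst^* p` acts on `H²(S(ℂ); ℂ)` by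
`x ↦ c₀ • Σᵢ B(x, uᵢ) • vᵢ` (`corr_cross`, `corr_map_snd_top`, `corr_map_fst_top`).
[cite: Fulton1998, §16.1] [cite: FultonYoungTableaux1997, Appendix B §B.1 (6)] -/
theorem corr_normalForm (μ : OrientationFamily) {c₀ : ℂ}
    (hFI : complexGysin μ (IsSmoothProjective.tensor_holds hS hS) hS (fst S S)
        (rfl : 2 * 2 + 2 * 2 = 0 + 2 * (2 + 2)) (complexBetti.map (snd S S) (2 * 2) p) =
      c₀ • singularCohomology.one ℂ (ComplexPoints S))
    {ι : Type} [Fintype ι] (v u : ι → complexBetti S (2 * 1)) (t₄ t₀ : ℂ) (x : complexBetti S (2 * 1)) :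
    complexGysin μ (IsSmoothProjective.tensor_holds hS hS) hS (fst S S)
        (rfl : 2 * 1 + 2 * 2 + 2 * 2 = 2 * 1 + 2 * (2 + 2))
        (cupProduct (rfl : 2 * 1 + 2 * 2 = 2 * 1 + 2 * 2) (complexBetti.map (snd S S) (2 * 1) x)
          ((∑ i, cupProduct (rfl : 2 * 1 + 2 * 1 = 2 * 2) (complexBetti.map (fst S S) (2 * 1) (v i))
              (complexBetti.map (snd S S) (2 * 1) (u i))) +
            t₄ • complexBetti.map (snd S S) (2 * 2) p + t₀ • complexBetti.map (fst S S) (2 * 2) p)) =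
      c₀ • ∑ i, B x (u i) • v i := by
  simp only [map_add, map_sum, map_smul, corr_cross hS hB μ hFI, corr_map_snd_top hS μ,
    corr_map_fst_top hS μ, smul_zero, add_zero, Finset.smul_sum, smul_smul]

/-- `(fst^* a + snd^* b) ∪ (fst^* y ∪ snd^* p) = B(a, y) • (fst^* p ∪ snd^* p)` on the square of a
surface (`b ∪ p ∈ H⁶(S(ℂ)) = 0`). [cite: HatcherAT2002, §3.2 Thm. 3.16] -/
theorem kunnethTwo_cup_cross_top (a b y : complexBetti S (2 * 1)) :
    cupProduct (rfl : 2 * 1 + 2 * 3 = 2 * 4)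
        (complexBetti.map (fst S S) (2 * 1) a + complexBetti.map (snd S S) (2 * 1) b)
        (cupProduct (rfl : 2 * 1 + 2 * 2 = 2 * 3) (complexBetti.map (fst S S) (2 * 1) y)
          (complexBetti.map (snd S S) (2 * 2) p)) =
      B a y • cupProduct (rfl : 2 * 2 + 2 * 2 = 2 * 4) (complexBetti.map (fst S S) (2 * 2) p)
        (complexBetti.map (snd S S) (2 * 2) p) := by
  haveI := subsingleton_complexBetti hS (show 2 * 2 < 2 * 3 by norm_num)
  rw [map_add, LinearMap.add_apply,
    map_fst_cup_cross (rfl : 2 * 1 + 2 * 2 = 2 * 3) (rfl : 2 * 1 + 2 * 3 = 2 * 4)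
      (rfl : 2 * 1 + 2 * 1 = 2 * 2) (rfl : 2 * 2 + 2 * 2 = 2 * 4),
    map_snd_cup_cross (rfl : 2 * 1 + 2 * 2 = 2 * 3) (rfl : 2 * 1 + 2 * 3 = 2 * 4)
      (rfl : 2 * 1 + 2 * 2 = 2 * 3) (rfl : 2 * 1 + 2 * 3 = 2 * 4),
    Subsingleton.elim (cupProduct _ b p) 0, map_zero, map_zero, smul_zero, add_zero, hB a y, map_smul,
    map_smul, LinearMap.smul_apply]

/-- `(fst^* a + snd^* b) ∪ (fst^* p ∪ snd^* y) = B(b, y) • (fst^* p ∪ snd^* p)` on the square of a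
surface (`a ∪ p ∈ H⁶(S(ℂ)) = 0`). [cite: HatcherAT2002, §3.2 Thm. 3.16] -/
theorem kunnethTwo_cup_top_cross (a b y : complexBetti S (2 * 1)) :
    cupProduct (rfl : 2 * 1 + 2 * 3 = 2 * 4)
        (complexBetti.map (fst S S) (2 * 1) a + complexBetti.map (snd S S) (2 * 1) b)
        (cupProduct (rfl : 2 * 2 + 2 * 1 = 2 * 3) (complexBetti.map (fst S S) (2 * 2) p)
          (complexBetti.map (snd S S) (2 * 1) y)) =
      B b y • cupProduct (rfl : 2 * 2 + 2 * 2 = 2 * 4) (complexBetti.map (fst S S) (2 * 2) p)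
        (complexBetti.map (snd S S) (2 * 2) p) := by
  haveI := subsingleton_complexBetti hS (show 2 * 2 < 2 * 3 by norm_num)
  rw [map_add, LinearMap.add_apply,
    map_fst_cup_cross (rfl : 2 * 2 + 2 * 1 = 2 * 3) (rfl : 2 * 1 + 2 * 3 = 2 * 4)
      (rfl : 2 * 1 + 2 * 2 = 2 * 3) (rfl : 2 * 3 + 2 * 1 = 2 * 4),
    map_snd_cup_cross (rfl : 2 * 2 + 2 * 1 = 2 * 3) (rfl : 2 * 1 + 2 * 3 = 2 * 4)
      (rfl : 2 * 1 + 2 * 1 = 2 * 2) (rfl : 2 * 2 + 2 * 2 = 2 * 4),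
    Subsingleton.elim (cupProduct _ a p) 0, map_zero, map_zero, LinearMap.zero_apply, zero_add,
    hB b y, map_smul, map_smul]
  norm_num

/-- `(fst^* a ∪ snd^* p + fst^* p ∪ snd^* b) ∪ fst^* y = B(a, y) • (fst^* p ∪ snd^* p)` on the square of
a surface (`p ∪ y ∈ H⁶(S(ℂ)) = 0`). [cite: HatcherAT2002, §3.2 Thm. 3.16] -/
theorem kunnethSix_cup_map_fst (a b y : complexBetti S (2 * 1)) :
    cupProduct (rfl : 2 * 3 + 2 * 1 = 2 * 4)
        (cupProduct (rfl : 2 * 1 + 2 * 2 = 2 * 3) (complexBetti.map (fst S S) (2 * 1) a)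
            (complexBetti.map (snd S S) (2 * 2) p) +
          cupProduct (rfl : 2 * 2 + 2 * 1 = 2 * 3) (complexBetti.map (fst S S) (2 * 2) p)
            (complexBetti.map (snd S S) (2 * 1) b))
        (complexBetti.map (fst S S) (2 * 1) y) =
      B a y • cupProduct (rfl : 2 * 2 + 2 * 2 = 2 * 4) (complexBetti.map (fst S S) (2 * 2) p)
        (complexBetti.map (snd S S) (2 * 2) p) := by
  haveI := subsingleton_complexBetti hS (show 2 * 2 < 2 * 3 by norm_num)
  rw [map_add, LinearMap.add_apply,
    cross_cup_map_fst (rfl : 2 * 1 + 2 * 2 = 2 * 3) (rfl : 2 * 3 + 2 * 1 = 2 * 4)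
      (rfl : 2 * 1 + 2 * 1 = 2 * 2) (rfl : 2 * 2 + 2 * 2 = 2 * 4),
    cross_cup_map_fst (rfl : 2 * 2 + 2 * 1 = 2 * 3) (rfl : 2 * 3 + 2 * 1 = 2 * 4)
      (rfl : 2 * 2 + 2 * 1 = 2 * 3) (rfl : 2 * 3 + 2 * 1 = 2 * 4),
    Subsingleton.elim (cupProduct _ p y) 0, map_zero, map_zero, LinearMap.zero_apply, smul_zero,
    add_zero, hB a y, map_smul, map_smul, LinearMap.smul_apply]
  norm_num

/-- `(fst^* a ∪ snd^* p + fst^* p ∪ snd^* b) ∪ snd^* y = B(b, y) • (fst^* p ∪ snd^* p)` on the square of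
a surface (`p ∪ y ∈ H⁶(S(ℂ)) = 0`). [cite: HatcherAT2002, §3.2 Thm. 3.16] -/
theorem kunnethSix_cup_map_snd (a b y : complexBetti S (2 * 1)) :
    cupProduct (rfl : 2 * 3 + 2 * 1 = 2 * 4)
        (cupProduct (rfl : 2 * 1 + 2 * 2 = 2 * 3) (complexBetti.map (fst S S) (2 * 1) a)
            (complexBetti.map (snd S S) (2 * 2) p) +
          cupProduct (rfl : 2 * 2 + 2 * 1 = 2 * 3) (complexBetti.map (fst S S) (2 * 2) p)
            (complexBetti.map (snd S S) (2 * 1) b))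
        (complexBetti.map (snd S S) (2 * 1) y) =
      B b y • cupProduct (rfl : 2 * 2 + 2 * 2 = 2 * 4) (complexBetti.map (fst S S) (2 * 2) p)
        (complexBetti.map (snd S S) (2 * 2) p) := by
  haveI := subsingleton_complexBetti hS (show 2 * 2 < 2 * 3 by norm_num)
  rw [map_add, LinearMap.add_apply,
    cross_cup_map_snd (rfl : 2 * 1 + 2 * 2 = 2 * 3) (rfl : 2 * 3 + 2 * 1 = 2 * 4)
      (rfl : 2 * 2 + 2 * 1 = 2 * 3) (rfl : 2 * 1 + 2 * 3 = 2 * 4),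
    cross_cup_map_snd (rfl : 2 * 2 + 2 * 1 = 2 * 3) (rfl : 2 * 3 + 2 * 1 = 2 * 4)
      (rfl : 2 * 1 + 2 * 1 = 2 * 2) (rfl : 2 * 2 + 2 * 2 = 2 * 4),
    Subsingleton.elim (cupProduct _ p y) 0, map_zero, map_zero, zero_add, hB b y, map_smul, map_smul]

end Surface

end Summit.HodgeConjecture.HodgeConjecture.Theorems.NikulinTwinTransport

end
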